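import Mathlib
import Summits.NavierStokesRegularity.NavierStokesRegularity.Theorems.ThreadingFluxHorizonTowerProfileLambda
import Literature.Analysis.FluidPDE.BiotSavartNewtonKernel
import HarnessLib

/-!
# Crux `PoloidalLiouville` (stmt-NavierStokesRegularity-1222, wall W1), crux idea «horizon-threading-tower» (ns-idea-15):
# RUNG R3 of the identification chain — `curl λ` in closed form, `λ = U_H × curl U_H`

Support file (Theorems-side tooling, `--supports stmt-NavierStokesRegularity-1222 --as helper`; seat ns-wall-eng-7 g3, cell ns-wall-extremal).
Third rung of the STRUCTURED identification chain of the engine identity E-𝔏₂ (DATUM B-ht2, `pub/ns-wall-extremal/ARM-B/w7g3/L2-IDENTITY.md` §2 (3)).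
For `H` smooth, homogeneous of degree `l ≥ 1`, harmonic, `x ≠ 0`, with `κ = (l−1)(l+2)`, `G = ‖∇H‖²`:

* `HorizonTower.curl_smul_eq_cross` — `curl(φ f)(x) = φ(x) curl f(x) + ∇φ(x) × f(x)` (tree's `curl_smul` in cross-product form);
* `HorizonTower.gradient_const_mul_add_const_mul` — `∇(a f + b g) = a∇f + b∇g`;
* `HorizonTower.curl_lamb_horizonProfile` — ★ `curl(U_H × curl U_H)(x) = (4κl²(‖x‖²)^{−l−1}H) • (∇H × x) − (2κ(‖x‖²)^{−l}) • (∇G × x)`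
  (so `λ` has tangential curl: `𝔏₁[U_H] = r⟪x, curl λ⟫ = 0`, ARM A's `horizonL1_horizonProfile`, recovered).

Pure vector calculus; information-grade for W1/W2; `PoloidalLiouville` (1222) / NS regularity OPEN and untouched. [folklore]
-/

-- the summit and its single problem share the name (D-0017 nested layout)
set_option linter.dupNamespace false

noncomputable section

open Set Function Filter Topology
open scoped Topology RealInnerProductSpace
open Literature.Analysis.FluidPDE
open Literature.Geometry.DiscreteGeometry (inner_fin3 norm_sq_fin3)

namespace Summit.NavierStokesRegularity.NavierStokesRegularity.Theorems.PoloidalLiouville.HorizonTower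

open PoloidalField

/-- `curl(φ f)(x) = φ(x) • curl f(x) + ∇φ(x) × f(x)` at a point where `φ` and `f` are differentiable.
[cite: MajdaBertozziCUP2002, §1.1 (vector identities)] -/
theorem curl_smul_eq_cross {φ : E3 → ℝ} {f : E3 → E3} {x : E3} (hφ : DifferentiableAt ℝ φ x) (hf : DifferentiableAt ℝ f x) :
    curl (fun y => φ y • f y) x = φ x • curl f x + cross (gradient φ x) (f x) := by
  rw [curl_smul hφ hf, fderiv_eq_innerSL_gradient, curlCLM_smulRight_innerSL]

/-- `∇(a f + b g)(x) = a ∇f(x) + b ∇g(x)` for constants `a`, `b`. [folklore] -/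
theorem gradient_const_mul_add_const_mul {f g : E3 → ℝ} {x : E3} (hf : DifferentiableAt ℝ f x) (hg : DifferentiableAt ℝ g x)
    (a b : ℝ) : gradient (fun y => a * f y + b * g y) x = a • gradient f x + b • gradient g x := by
  apply ext_inner_right ℝ
  intro v
  rw [inner_gradient_left, inner_add_left, real_inner_smul_left, real_inner_smul_left, inner_gradient_left, inner_gradient_left,
    fderiv_fun_add (hf.const_mul a) (hg.const_mul b), fderiv_const_mul hf, fderiv_const_mul hg]
  simp

/-- `(c • u + d • x) × u = d • (x × u)` (cross of a vector with itself vanishes), coordinatewise.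
[cite: MajdaBertozziCUP2002, §1.1 (vector identities)] -/
theorem cross_smul_add_smul_left (c d : ℝ) (u x : E3) : cross (c • u + d • x) u = -(d • cross u x) := by
  obtain ⟨c0, c1, c2⟩ := cross_fin3 (c • u + d • x) u
  obtain ⟨d0, d1, d2⟩ := cross_fin3 u x
  ext i
  fin_cases i
  · simp only [Fin.zero_eta, Fin.isValue, c0, PiLp.add_apply, PiLp.smul_apply, smul_eq_mul, PiLp.neg_apply, d0]; ring
  · simp only [Fin.mk_one, Fin.isValue, c1, PiLp.add_apply, PiLp.smul_apply, smul_eq_mul, PiLp.neg_apply, d1]; ring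
  · simp only [Fin.reduceFinMk, Fin.isValue, c2, PiLp.add_apply, PiLp.smul_apply, smul_eq_mul, PiLp.neg_apply, d2]; ring

section CurlLambda

variable {l : ℕ} {H : E3 → ℝ}

/-- `∇H` is smooth when `H` is. -/
theorem contDiff_gradient (hH : ContDiff ℝ (⊤ : ℕ∞) H) {n : WithTop ℕ∞} (hn : n ≤ (⊤ : ℕ∞)) : ContDiff ℝ n (gradient H) := by
  have hD : ContDiff ℝ n (fderiv ℝ H) := by
    have h := hH.fderiv_right (m := (⊤ : ℕ∞)) (by norm_cast)
    exact h.of_le hn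
  exact (InnerProductSpace.toDual ℝ E3).symm.contDiff.comp hD

/-- ★ **R3: `curl λ` in closed form.**  `curl(U_H × curl U_H)(x) = (4κl²(‖x‖²)^{−l−1}H(x)) • (∇H(x) × x) − (2κ(‖x‖²)^{−l}) • (∇G(x) × x)`,
`κ = (l−1)(l+2)`, `G = ‖∇H‖²`. [folklore] -/
theorem curl_lamb_horizonProfile (hl : 1 ≤ l) (hH : ContDiff ℝ (⊤ : ℕ∞) H)
    (hhom : ∀ (c : ℝ) (y : E3), H (c • y) = c ^ l * H y) (hharm : ∀ y, Laplacian.laplacian H y = 0) {x : E3} (hx : x ≠ 0) :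
    curl (fun y => cross (horizonProfile l H 0 y) (curl (horizonProfile l H 0) y)) x
      = (4 * (((l : ℝ) - 1) * ((l : ℝ) + 2)) * (l : ℝ) ^ 2 * (‖x‖ ^ 2) ^ (-(l : ℝ) - 1) * H x) • cross (gradient H x) x
        - (2 * (((l : ℝ) - 1) * ((l : ℝ) + 2)) * (‖x‖ ^ 2) ^ (-(l : ℝ))) • cross (gradient (fun y => ‖gradient H y‖ ^ 2) x) x := by
  have hHd : ∀ z, DifferentiableAt ℝ H z := fun z => (hH.differentiable (by simp)).differentiableAt
  have hGd : ∀ z, DifferentiableAt ℝ (gradient H) z := fun z => ((contDiff_gradient hH (n := 1) (by norm_cast)).differentiable (by simp)).differentiableAt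
  have hNd : ∀ z, DifferentiableAt ℝ (fun y => ‖gradient H y‖ ^ 2) z := fun z => (hGd z).norm_sq ℝ
  have hopen : ∀ᶠ y in 𝓝 x, y ≠ (0 : E3) := isOpen_compl_singleton.mem_nhds hx
  set κ : ℝ := ((l : ℝ) - 1) * ((l : ℝ) + 2) with hκ
  -- the two scalar coefficients of R2 as functions
  set A : E3 → ℝ := fun y => κ * ((l : ℝ) * ((l : ℝ) + 1)) * (H y * (‖y‖ ^ 2) ^ (-(l : ℝ))) with hA
  set B : E3 → ℝ := fun y => (-2 * κ) * (‖gradient H y‖ ^ 2 * (‖y‖ ^ 2) ^ (-(l : ℝ)))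
      + (-κ * (l : ℝ) ^ 2 * ((l : ℝ) - 1)) * (H y ^ 2 * (‖y‖ ^ 2) ^ (-(l : ℝ) - 1)) with hB
  have hev : (fun y => cross (horizonProfile l H 0 y) (curl (horizonProfile l H 0) y)) =ᶠ[𝓝 x] fun y => A y • gradient H y + B y • y := by
    filter_upwards [hopen] with y hy
    rw [cross_horizonProfile_curl hl hH hhom hharm hy, hA, hB, sub_eq_add_neg, ← neg_smul]
    congr 1 <;> (congr 1; ring)
  rw [curl_eq_curlCLM, hev.fderiv_eq, ← curl_eq_curlCLM]
  -- differentiability of the coefficients at `x`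
  have hR : ∀ p : ℝ, DifferentiableAt ℝ (fun y : E3 => (‖y‖ ^ 2) ^ p) x := fun p =>
    (contDiffAt_rpow_normSq hx p (n := 1)).differentiableAt (by simp)
  have hH2 : DifferentiableAt ℝ (fun y => H y ^ 2) x := (hHd x).pow 2
  have hρA : DifferentiableAt ℝ (fun y : E3 => H y * (‖y‖ ^ 2) ^ (-(l : ℝ))) x := (hHd x).mul (hR _)
  have hρB1 : DifferentiableAt ℝ (fun y : E3 => ‖gradient H y‖ ^ 2 * (‖y‖ ^ 2) ^ (-(l : ℝ))) x := (hNd x).mul (hR _)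
  have hρB2 : DifferentiableAt ℝ (fun y : E3 => H y ^ 2 * (‖y‖ ^ 2) ^ (-(l : ℝ) - 1)) x := hH2.mul (hR _)
  have hAd : DifferentiableAt ℝ A x := hρA.const_mul _
  have hBd : DifferentiableAt ℝ B x := (hρB1.const_mul _).add (hρB2.const_mul _)
  have h1 : DifferentiableAt ℝ (fun y => A y • gradient H y) x := hAd.smul (hGd x)
  have h2 : DifferentiableAt ℝ (fun y => B y • y) x := hBd.smul differentiableAt_id
  rw [curl_eq_curlCLM, fderiv_fun_add h1 h2, map_add, ← curl_eq_curlCLM, ← curl_eq_curlCLM, curl_smul_eq_cross hAd (hGd x),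
    curl_smul_self hBd, curl_gradient_eq_zero_of_contDiffAt (hH.contDiffAt.of_le (by norm_cast)), smul_zero, zero_add]
  -- the gradients of the coefficients
  have hgA : gradient A x = (κ * ((l : ℝ) * ((l : ℝ) + 1)) * (‖x‖ ^ 2) ^ (-(l : ℝ))) • gradient H x
      + (κ * ((l : ℝ) * ((l : ℝ) + 1)) * (2 * (-(l : ℝ) * (‖x‖ ^ 2) ^ (-(l : ℝ) - 1)) * H x)) • x := by
    rw [hA, gradient_mul_apply (differentiableAt_const _) hρA, gradient_mul_rpow_normSq hx (hHd x)]
    have h0 : gradient (fun _ : E3 => κ * ((l : ℝ) * ((l : ℝ) + 1))) x = 0 := by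
      unfold gradient; rw [fderiv_const_apply]; simp
    rw [h0, smul_zero, add_zero, smul_add, smul_smul, smul_smul]
  have hG2 : gradient (fun y => H y ^ 2) x = (2 * H x) • gradient H x := by
    have : (fun y => H y ^ 2) = fun y => H y * H y := funext fun y => sq (H y)
    rw [this, gradient_mul_apply (hHd x) (hHd x), ← add_smul]; congr 1; ring
  have hgB : gradient B x = (-2 * κ) • ((‖x‖ ^ 2) ^ (-(l : ℝ)) • gradient (fun y => ‖gradient H y‖ ^ 2) x
        + (2 * (-(l : ℝ) * (‖x‖ ^ 2) ^ (-(l : ℝ) - 1)) * ‖gradient H x‖ ^ 2) • x)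
      + (-κ * (l : ℝ) ^ 2 * ((l : ℝ) - 1)) • ((‖x‖ ^ 2) ^ (-(l : ℝ) - 1) • ((2 * H x) • gradient H x)
        + (2 * ((-(l : ℝ) - 1) * (‖x‖ ^ 2) ^ (-(l : ℝ) - 1 - 1)) * H x ^ 2) • x) := by
    rw [hB, gradient_const_mul_add_const_mul hρB1 hρB2, gradient_mul_rpow_normSq hx (hNd x),
      gradient_mul_rpow_normSq hx hH2, hG2]
  rw [hgA, hgB]
  -- cross products: radial parts vanish, `(c∇H + d x) × ∇H = −d (∇H × x)`
  rw [cross_smul_add_smul_left]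
  have hlin : ∀ (p q r s : ℝ) (v : E3),
      cross (p • (q • v + r • x) + s • ((‖x‖ ^ 2) ^ (-(l : ℝ) - 1) • ((2 * H x) • gradient H x)
        + (2 * ((-(l : ℝ) - 1) * (‖x‖ ^ 2) ^ (-(l : ℝ) - 1 - 1)) * H x ^ 2) • x)) x
        = (p * q) • cross v x + (s * ((‖x‖ ^ 2) ^ (-(l : ℝ) - 1) * (2 * H x))) • cross (gradient H x) x := by
    intro p q r s v
    obtain ⟨c0, c1, c2⟩ := cross_fin3 (p • (q • v + r • x) + s • ((‖x‖ ^ 2) ^ (-(l : ℝ) - 1) • ((2 * H x) • gradient H x)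
        + (2 * ((-(l : ℝ) - 1) * (‖x‖ ^ 2) ^ (-(l : ℝ) - 1 - 1)) * H x ^ 2) • x)) x
    obtain ⟨d0, d1, d2⟩ := cross_fin3 v x
    obtain ⟨e0, e1, e2⟩ := cross_fin3 (gradient H x) x
    ext i
    fin_cases i
    · simp only [Fin.zero_eta, Fin.isValue, c0, PiLp.add_apply, PiLp.smul_apply, smul_eq_mul, d0, e0]; ring
    · simp only [Fin.mk_one, Fin.isValue, c1, PiLp.add_apply, PiLp.smul_apply, smul_eq_mul, d1, e1]; ring
    · simp only [Fin.reduceFinMk, Fin.isValue, c2, PiLp.add_apply, PiLp.smul_apply, smul_eq_mul, d2, e2]; ring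
  rw [hlin]
  -- collect (a linear combination of `∇H × x` and `∇G × x`)
  module

end CurlLambda

end Summit.NavierStokesRegularity.NavierStokesRegularity.Theorems.PoloidalLiouville.HorizonTower

end
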